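import Summits.CriticalPhenomena.SAWScalingLimit.Theses.SAWDefectDecoherence
import Summits.CriticalPhenomena.SAWScalingLimit.Theorems.SAWDefectDecoherenceBoundaryClosureRPickEngineRemark
import Summits.CriticalPhenomena.SAWScalingLimit.Theorems.SAWDefectDecoherenceBoundaryClosureRLocalL1Necessity
import HarnessLib

/-!
# The local `L¹` law from the local sup law (crux `BoundaryClosureR`, stmt-CriticalPhenomena-14004,
line `pick-half-plane`, stub `stub_localL1OfSup : LocalSupBound → LocalL1Bound`)

Mid-edge counting.  The midpoints of the edges of the honeycomb lattice `ℍ` (dual of the unit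
triangular lattice) have brick coordinates `re = (integer)/4`, `im = (integer)·√3/12`
(`hexMidpoint_coords`), and distinct edges have distinct midpoints (`hexMidpoint_injOn_edgeSet`).
Hence `z ↦ (⌊4·re(mid z)⌋, ⌊4√3·im(mid z)⌋)` is injective on the edges of `ℍ`, and the edges whose
`δ`-scaled midpoint lies in the disc of radius `R` are mapped into the integer box `[-T, T]²`,
`T = ⌈7R/δ⌉`; so there are at most `(14R + 3)²/δ²` of them for `0 < δ ≤ 1`
(`card_mul_sq_le_of_scaled_midpoints`).  Consequently the local sup law of the line
(`‖F_δ(z)‖ ≤ C ‖F_δ(b δ)‖` at every mid-edge `z` of `Ω_δ` with `δ·mid z` in a compact `K` of the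
carrier and the flat pieces, away from the root) implies the local `L¹` law
(`δ² Σ_{δ·mid z ∈ K} ‖F_δ(z)‖ ≤ C_K ‖F_δ(b δ)‖` for compacts `K ⊆ D.carrier`): a compact of the
carrier misses the pinned root `x ∈ ∂D` (`mem_frontier_of_flat_piece`), and
`δ² · #{z : δ·mid z ∈ K} ≤ (14R + 3)²` for `K ⊆ closedBall 0 R`
(`localL1Bound_of_localSupBound`, hypotheses = the line's `LocalSupBound` / `LocalL1Bound` with
`AdmissibleFamily`, `PinnedFlatRoot`, `flatPoints` unfolded verbatim).
References: Duminil-Copin–Smirnov, Ann. of Math. 175 (2012), §2 (domains, mid-edges).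
-/

noncomputable section

open scoped BigOperators Topology
open Filter Set
open Literature.Probability.LatticeModels Literature.Probability.RandomPlanarGeometry
open Literature.Probability.RandomPlanarGeometry.SAW
open Summit.CriticalPhenomena.SAWScalingLimit.Theorems.MassRatio.Negative
  (hexDomainMidEdges_finite pos row)
open Summit.CriticalPhenomena.SAWScalingLimit.Theorems.PickHalfPlane.Engine
  (mem_frontier_of_flat_piece)
open Summit.CriticalPhenomena.SAWScalingLimit.Theorems.PickHalfPlane.LocalL1
  (hexMidpoint_coords hexMidpoint_injOn_edgeSet)

namespace Summit.CriticalPhenomena.SAWScalingLimit.Theorems.PickHalfPlane.LocalL1OfSup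

/-! ### 1. Integer coordinates of midpoints and the counting bound -/

/-- The midpoint of any pair of faces has `4·re ∈ ℤ` and `4√3·im ∈ ℤ` (brick coordinates:
`re = (pos u + pos v + 2)/4`, `im = (√3/12)(3 row u + 3 row v + u.2 + v.2 + 2)`). [folklore] -/
theorem exists_int_coords (z : Sym2 HexVertex) :
    ∃ a b : ℤ, 4 * (hexMidpoint z).re = a ∧ 4 * Real.sqrt 3 * (hexMidpoint z).im = b := by
  induction z using Sym2.ind with
  | h u v =>
    obtain ⟨hre, him⟩ := hexMidpoint_coords u v
    refine ⟨pos u + pos v + 2,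
      3 * (row u + row v) + ((u.2 : ℕ) : ℤ) + ((v.2 : ℕ) : ℤ) + 2, ?_, ?_⟩
    · rw [hre]; push_cast; ring
    · have h3 : Real.sqrt 3 * Real.sqrt 3 = 3 := Real.mul_self_sqrt (by norm_num)
      rw [him]; push_cast
      linear_combination
        ((row u : ℝ) + row v + ((((u.2 : ℕ) : ℝ) + ((v.2 : ℕ) : ℝ) + 2) / 3)) * h3

/-- The integer brick coordinates `(⌊4·re(mid z)⌋, ⌊4√3·im(mid z)⌋)` determine the midpoint, hence
(by `hexMidpoint_injOn_edgeSet`) the edge: the coordinate map is injective on the edges of `ℍ`.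
[folklore] -/
theorem injOn_int_coords :
    Set.InjOn (fun z : Sym2 HexVertex =>
      (⌊4 * (hexMidpoint z).re⌋, ⌊4 * Real.sqrt 3 * (hexMidpoint z).im⌋)) hexGraph.edgeSet := by
  intro z hz z' hz' h
  obtain ⟨a, b, ha, hb⟩ := exists_int_coords z
  obtain ⟨a', b', ha', hb'⟩ := exists_int_coords z'
  simp only [Prod.mk.injEq] at h
  rw [ha, hb, ha', hb', Int.floor_intCast, Int.floor_intCast, Int.floor_intCast,
    Int.floor_intCast] at h
  obtain ⟨rfl, rfl⟩ := h
  refine hexMidpoint_injOn_edgeSet hz hz' (Complex.ext ?_ ?_)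
  · have h1 : 4 * (hexMidpoint z).re = 4 * (hexMidpoint z').re := by rw [ha, ha']
    linarith
  · have h3 : (0 : ℝ) < 4 * Real.sqrt 3 := by positivity
    have h1 : 4 * Real.sqrt 3 * (hexMidpoint z).im = 4 * Real.sqrt 3 * (hexMidpoint z').im := by
      rw [hb, hb']
    exact mul_left_cancel₀ h3.ne' h1

/-- **Mid-edge counting.** For `0 < δ ≤ 1` and `R ≥ 0`, a finite set of edges of `ℍ` whose
`δ`-scaled midpoints lie in the closed disc of radius `R` has at most `(14R + 3)²/δ²` elements
(injection into the integer box `[-⌈7R/δ⌉, ⌈7R/δ⌉]²` by the brick coordinates). [folklore] -/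
theorem card_mul_sq_le_of_scaled_midpoints {δ R : ℝ} (hδ : 0 < δ) (hδ1 : δ ≤ 1) (hR : 0 ≤ R)
    (s : Finset (Sym2 HexVertex))
    (hs : ∀ z ∈ s, z ∈ hexGraph.edgeSet ∧ ‖(δ : ℂ) * hexMidpoint z‖ ≤ R) :
    (s.card : ℝ) * δ ^ 2 ≤ (14 * R + 3) ^ 2 := by
  set T : ℤ := ⌈7 * R / δ⌉ with hTdef
  set φ : Sym2 HexVertex → ℤ × ℤ := fun z =>
    (⌊4 * (hexMidpoint z).re⌋, ⌊4 * Real.sqrt 3 * (hexMidpoint z).im⌋) with hφdef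
  have hT0 : 0 ≤ T := Int.ceil_nonneg (by positivity)
  have hTge : 7 * R / δ ≤ (T : ℝ) := Int.le_ceil _
  have hs3 : Real.sqrt 3 ≤ 7 / 4 := by
    nlinarith [Real.sq_sqrt (show (0 : ℝ) ≤ 3 by norm_num), Real.sqrt_nonneg 3]
  -- the coordinate map sends `s` into the box
  have hmaps : ∀ z ∈ s, φ z ∈ Finset.Icc (-T) T ×ˢ Finset.Icc (-T) T := by
    intro z hz
    obtain ⟨-, hzR⟩ := hs z hz
    obtain ⟨a, b, ha, hb⟩ := exists_int_coords z
    have hnorm : ‖hexMidpoint z‖ ≤ R / δ := by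
      rw [le_div_iff₀ hδ, mul_comm]
      rw [norm_mul, Complex.norm_real, Real.norm_eq_abs, abs_of_pos hδ] at hzR
      exact hzR
    have hRδ : 0 ≤ R / δ := by positivity
    obtain ⟨hre1, hre2⟩ := abs_le.1 (Complex.abs_re_le_norm (hexMidpoint z))
    obtain ⟨him1, him2⟩ := abs_le.1 (Complex.abs_im_le_norm (hexMidpoint z))
    have h43 : (0 : ℝ) ≤ 4 * Real.sqrt 3 := by positivity
    have hi1 : 4 * Real.sqrt 3 * (hexMidpoint z).im ≤ 4 * Real.sqrt 3 * ‖hexMidpoint z‖ :=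
      mul_le_mul_of_nonneg_left him2 h43
    have hi2 : 4 * Real.sqrt 3 * -‖hexMidpoint z‖ ≤ 4 * Real.sqrt 3 * (hexMidpoint z).im :=
      mul_le_mul_of_nonneg_left him1 h43
    have hi3 : 4 * Real.sqrt 3 * ‖hexMidpoint z‖ ≤ 4 * Real.sqrt 3 * (R / δ) :=
      mul_le_mul_of_nonneg_left hnorm h43
    have hi4 : 4 * Real.sqrt 3 * (R / δ) ≤ 7 * (R / δ) :=
      mul_le_mul_of_nonneg_right (by linarith) hRδ
    have h7 : 7 * (R / δ) = 7 * R / δ := by ring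
    have ha1 : (a : ℝ) ≤ T := by rw [← ha]; linarith
    have ha2 : -(T : ℝ) ≤ a := by rw [← ha]; linarith
    have hb1 : (b : ℝ) ≤ T := by rw [← hb]; linarith
    have hb2 : -(T : ℝ) ≤ b := by rw [← hb]; linarith
    simp only [hφdef, Finset.mem_product, Finset.mem_Icc]
    rw [ha, hb, Int.floor_intCast, Int.floor_intCast]
    exact ⟨⟨by exact_mod_cast ha2, by exact_mod_cast ha1⟩, by exact_mod_cast hb2,
      by exact_mod_cast hb1⟩
  have hinj : Set.InjOn φ s := fun z hz z' hz' h =>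
    injOn_int_coords (hs z hz).1 (hs z' hz').1 h
  have hcard := Finset.card_le_card_of_injOn φ hmaps hinj
  rw [Finset.card_product, Int.card_Icc] at hcard
  have hcardZ : (s.card : ℤ) ≤ (2 * T + 1) * (2 * T + 1) := by
    have h' : ((s.card : ℕ) : ℤ) ≤ (((T + 1 - -T).toNat * (T + 1 - -T).toNat : ℕ) : ℤ) := by
      exact_mod_cast hcard
    rw [Nat.cast_mul, Int.toNat_of_nonneg (by omega)] at h'
    convert h' using 1; ring
  have hcardR : (s.card : ℝ) ≤ (2 * T + 1) * (2 * T + 1) := by exact_mod_cast hcardZ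
  have hT0R : (0 : ℝ) ≤ T := by exact_mod_cast hT0
  -- `(2T + 1) δ ≤ 14 R + 3`
  have hTδ : (T : ℝ) * δ ≤ 7 * R + δ := by
    have h1 : (T : ℝ) < 7 * R / δ + 1 := Int.ceil_lt_add_one _
    have h2 := mul_lt_mul_of_pos_right h1 hδ
    rw [add_mul, div_mul_cancel₀ _ hδ.ne', one_mul] at h2
    exact h2.le
  have hle : (2 * (T : ℝ) + 1) * δ ≤ 14 * R + 3 := by nlinarith
  have h0 : 0 ≤ (2 * (T : ℝ) + 1) * δ := by positivity
  calc (s.card : ℝ) * δ ^ 2 ≤ (2 * T + 1) * (2 * T + 1) * δ ^ 2 := by gcongr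
    _ = ((2 * (T : ℝ) + 1) * δ) ^ 2 := by ring
    _ ≤ (14 * R + 3) ^ 2 := pow_le_pow_left₀ h0 hle 2

/-! ### 2. The reduction `LocalSupBound → LocalL1Bound` -/

/-- **The local `L¹` law from the local sup law** (stub `stub_localL1OfSup` of the line
`pick-half-plane`, statements `LocalSupBound`/`LocalL1Bound` with `AdmissibleFamily`,
`PinnedFlatRoot`, `flatPoints` unfolded verbatim).  For an admissible family, a pinned flat root
`x ≠ D.pt 1` and a compact `K ⊆ D.carrier`: `x ∉ K` (a pinned flat point is not in the carrier),
so the sup law applies on `K`; for `0 < δ ≤ 1` the mid-edges `z` of `Ω_δ` with `δ·mid z ∈ K`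
number at most `(14R+3)²/δ²` (`K ⊆ closedBall 0 R`), whence
`δ² Σ ‖F_δ(z)‖ ≤ (14R+3)² · max C 0 · ‖F_δ(b δ)‖`. [folklore] -/
theorem localL1Bound_of_localSupBound :
    (∀ (D : DobrushinDomain) (ρ : ℝ) (Λ : ℝ → Finset HexVertex) (m : ℝ → ℤ)
        (b : ℝ → Sym2 HexVertex),
      (0 < ρ ∧
        D.carrier ∩ Metric.ball (D.pt 1) ρ =
          {z : ℂ | (D.pt 1).im < z.im} ∩ Metric.ball (D.pt 1) ρ ∧
        (∀ᶠ δ : ℝ in 𝓝[>] 0, hexDomainSimplyConnected (Λ δ) ∧ b δ ∈ hexDomainBoundary (Λ δ) ∧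
          (hexGraph.induce ((Λ δ : Finset HexVertex) : Set HexVertex)).Preconnected ∧
          (∀ v ∈ Λ δ, (δ : ℂ) * hexCenter v ∈ D.carrier) ∧
          (∀ v : HexVertex, (δ : ℂ) * hexCenter v ∈ Metric.ball (D.pt 1) ρ →
            (v ∈ Λ δ ↔ m δ ≤ v.1 1))) ∧
        (∀ K : Set ℂ, IsCompact K → K ⊆ D.carrier →
          ∀ᶠ δ : ℝ in 𝓝[>] 0, ∀ v : HexVertex, (δ : ℂ) * hexCenter v ∈ K → v ∈ Λ δ) ∧
        Tendsto (fun δ : ℝ => (δ : ℂ) * hexMidpoint (b δ)) (𝓝[>] 0) (𝓝 (D.pt 1))) →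
      ∀ (x : ℂ) (e : ℝ → Sym2 HexVertex) (r : ℝ) (mr : ℝ → ℤ),
      (0 < r ∧
        D.carrier ∩ Metric.ball x r = {z : ℂ | x.im < z.im} ∩ Metric.ball x r ∧
        (∀ᶠ δ : ℝ in 𝓝[>] 0, e δ ∈ hexDomainBoundary (Λ δ) ∧
          Nonempty (HexMidEdgeSAW (Λ δ) (e δ) (b δ)) ∧
          (∀ v : HexVertex, (δ : ℂ) * hexCenter v ∈ Metric.ball x r →
            (v ∈ Λ δ ↔ mr δ ≤ v.1 1))) ∧
        Tendsto (fun δ : ℝ => (δ : ℂ) * hexMidpoint (e δ)) (𝓝[>] 0) (𝓝 x)) →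
      x ≠ D.pt 1 →
      ∀ K : Set ℂ, IsCompact K →
        K ⊆ D.carrier ∪
          (({z : ℂ | z.im = (D.pt 1).im} ∩ Metric.ball (D.pt 1) ρ) ∪
            ({z : ℂ | z.im = x.im} ∩ Metric.ball x r)) →
        x ∉ K →
        ∃ C : ℝ, ∀ᶠ δ : ℝ in 𝓝[>] 0, ∀ z ∈ hexDomainMidEdges (Λ δ),
          (δ : ℂ) * hexMidpoint z ∈ K →
          ‖hexParafermionicObservable (Λ δ) (e δ) hexCriticalFugacity (5 / 8) z‖ ≤
            C * ‖hexParafermionicObservable (Λ δ) (e δ) hexCriticalFugacity (5 / 8) (b δ)‖) →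
    ∀ (D : DobrushinDomain) (ρ : ℝ) (Λ : ℝ → Finset HexVertex) (m : ℝ → ℤ)
        (b : ℝ → Sym2 HexVertex),
      (0 < ρ ∧
        D.carrier ∩ Metric.ball (D.pt 1) ρ =
          {z : ℂ | (D.pt 1).im < z.im} ∩ Metric.ball (D.pt 1) ρ ∧
        (∀ᶠ δ : ℝ in 𝓝[>] 0, hexDomainSimplyConnected (Λ δ) ∧ b δ ∈ hexDomainBoundary (Λ δ) ∧
          (hexGraph.induce ((Λ δ : Finset HexVertex) : Set HexVertex)).Preconnected ∧
          (∀ v ∈ Λ δ, (δ : ℂ) * hexCenter v ∈ D.carrier) ∧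
          (∀ v : HexVertex, (δ : ℂ) * hexCenter v ∈ Metric.ball (D.pt 1) ρ →
            (v ∈ Λ δ ↔ m δ ≤ v.1 1))) ∧
        (∀ K : Set ℂ, IsCompact K → K ⊆ D.carrier →
          ∀ᶠ δ : ℝ in 𝓝[>] 0, ∀ v : HexVertex, (δ : ℂ) * hexCenter v ∈ K → v ∈ Λ δ) ∧
        Tendsto (fun δ : ℝ => (δ : ℂ) * hexMidpoint (b δ)) (𝓝[>] 0) (𝓝 (D.pt 1))) →
      ∀ (x : ℂ) (e : ℝ → Sym2 HexVertex) (r : ℝ) (mr : ℝ → ℤ),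
      (0 < r ∧
        D.carrier ∩ Metric.ball x r = {z : ℂ | x.im < z.im} ∩ Metric.ball x r ∧
        (∀ᶠ δ : ℝ in 𝓝[>] 0, e δ ∈ hexDomainBoundary (Λ δ) ∧
          Nonempty (HexMidEdgeSAW (Λ δ) (e δ) (b δ)) ∧
          (∀ v : HexVertex, (δ : ℂ) * hexCenter v ∈ Metric.ball x r →
            (v ∈ Λ δ ↔ mr δ ≤ v.1 1))) ∧
        Tendsto (fun δ : ℝ => (δ : ℂ) * hexMidpoint (e δ)) (𝓝[>] 0) (𝓝 x)) →
      x ≠ D.pt 1 →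
      ∀ K : Set ℂ, IsCompact K → K ⊆ D.carrier → ∃ C : ℝ, ∀ᶠ δ : ℝ in 𝓝[>] 0,
        δ ^ 2 * (∑ᶠ z ∈ {z : Sym2 HexVertex | z ∈ hexDomainMidEdges (Λ δ) ∧
            (δ : ℂ) * hexMidpoint z ∈ K},
          ‖hexParafermionicObservable (Λ δ) (e δ) hexCriticalFugacity (5 / 8) z‖) ≤
        C * ‖hexParafermionicObservable (Λ δ) (e δ) hexCriticalFugacity (5 / 8) (b δ)‖ := by
  intro hSup D ρ Λ m b hAF x e r mr hPR hx K hK hKD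
  -- the pinned root is not a point of the carrier, hence not of `K`
  obtain ⟨-, hxD⟩ := mem_frontier_of_flat_piece D hPR.1 hPR.2.1
  have hxK : x ∉ K := fun h => hxD (hKD h)
  obtain ⟨C₀, hC₀⟩ := hSup D ρ Λ m b hAF x e r mr hPR hx K hK
    (hKD.trans subset_union_left) hxK
  -- `K ⊆ closedBall 0 R`, `R ≥ 0`
  obtain ⟨R₀, hR₀⟩ := hK.isBounded.subset_closedBall (0 : ℂ)
  set R : ℝ := max R₀ 0 with hRdef
  have hR : 0 ≤ R := le_max_right _ _
  have hKR : K ⊆ Metric.closedBall (0 : ℂ) R :=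
    hR₀.trans (Metric.closedBall_subset_closedBall (le_max_left _ _))
  refine ⟨(14 * R + 3) ^ 2 * max C₀ 0, ?_⟩
  filter_upwards [hC₀, Ioc_mem_nhdsGT one_pos] with δ hδ hδ1
  set F : Sym2 HexVertex → ℂ := fun z =>
    hexParafermionicObservable (Λ δ) (e δ) hexCriticalFugacity (5 / 8) z with hFdef
  set E : Set (Sym2 HexVertex) :=
    {z : Sym2 HexVertex | z ∈ hexDomainMidEdges (Λ δ) ∧ (δ : ℂ) * hexMidpoint z ∈ K}
    with hEdef
  have hEfin : E.Finite := (hexDomainMidEdges_finite (Λ δ)).subset fun z hz => hz.1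
  show δ ^ 2 * (∑ᶠ z ∈ E, ‖F z‖) ≤ (14 * R + 3) ^ 2 * max C₀ 0 * ‖F (b δ)‖
  rw [finsum_mem_eq_finite_toFinset_sum _ hEfin]
  -- pointwise bound on `E`
  have hpt : ∀ z ∈ hEfin.toFinset, ‖F z‖ ≤ max C₀ 0 * ‖F (b δ)‖ := by
    intro z hz
    obtain ⟨hzΩ, hzK⟩ := hEfin.mem_toFinset.1 hz
    exact (hδ z hzΩ hzK).trans (mul_le_mul_of_nonneg_right (le_max_left _ _) (norm_nonneg _))
  have hsum : ∑ z ∈ hEfin.toFinset, ‖F z‖ ≤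
      hEfin.toFinset.card • (max C₀ 0 * ‖F (b δ)‖) := Finset.sum_le_card_nsmul _ _ _ hpt
  rw [nsmul_eq_mul] at hsum
  -- counting bound on `E`
  have hcount : (hEfin.toFinset.card : ℝ) * δ ^ 2 ≤ (14 * R + 3) ^ 2 := by
    refine card_mul_sq_le_of_scaled_midpoints hδ1.1 hδ1.2 hR _ fun z hz => ?_
    obtain ⟨hzΩ, hzK⟩ := hEfin.mem_toFinset.1 hz
    exact ⟨hzΩ.1, mem_closedBall_zero_iff.1 (hKR hzK)⟩
  have hM : 0 ≤ max C₀ 0 * ‖F (b δ)‖ := mul_nonneg (le_max_right _ _) (norm_nonneg _)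
  have hδ2 : 0 ≤ δ ^ 2 := by positivity
  calc δ ^ 2 * ∑ z ∈ hEfin.toFinset, ‖F z‖
      ≤ δ ^ 2 * ((hEfin.toFinset.card : ℝ) * (max C₀ 0 * ‖F (b δ)‖)) :=
        mul_le_mul_of_nonneg_left hsum hδ2
    _ = ((hEfin.toFinset.card : ℝ) * δ ^ 2) * (max C₀ 0 * ‖F (b δ)‖) := by ring
    _ ≤ (14 * R + 3) ^ 2 * (max C₀ 0 * ‖F (b δ)‖) := mul_le_mul_of_nonneg_right hcount hM
    _ = (14 * R + 3) ^ 2 * max C₀ 0 * ‖F (b δ)‖ := by ring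

end Summit.CriticalPhenomena.SAWScalingLimit.Theorems.PickHalfPlane.LocalL1OfSup

end
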